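import Summits.HodgeConjecture.HodgeConjecture.Theorems.Q8QuaternionicTransvectionDensity
import Summits.HodgeConjecture.HodgeConjecture.Theorems.Q8CommutatorDegreeTwoCore
import HarnessLib

/-!
# Route `Q8SymplecticPowers`, programme K2Q ∕ F-Q — brick F1A: **the adapted basis `(m_p, b m_p)` of a quadratic space with
# a quaternionic structure, and the quaternionic-unitary centraliser as the diagonal `Sp(Ω)`**

Support file for crux K2Q `PowersHodgeOfQuaternionCommutators` (stmt-HodgeConjecture-24191; `--supports … --as helper`;
nothing here closes an item). Prover seat `hodge-nonav-20241-p1` (g21). Pure linear algebra over a field `K` of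
characteristic `0` containing `i` (`i² = −1`), in the vocabulary of the rung `Q8CommutatorDegreeTwoCore*`: `V`
finite-dimensional, `Q` symmetric non-degenerate, `a, b` `Q`-isometries with `a² = b² = −1`, `ab = −ba`, `M = ker (a − i)`.

The coordinate model behind the all-powers stub `stub_higherPowersQ` (Goodman–Wallach §11.3.5: a form with a commuting
structure splits the space into blocks; here `V = M ⊕ bM`, `Q = Ω ⊗ J₂`):

* `exists_adaptedBasis` — there is a basis `β : Fin k ⊕ Fin k → V` with `a β(inl p) = i β(inl p)` and
  `β(inr p) = b β(inl p)` (a basis of `M` followed by its `b`-translate; `V = M ⊕ bM`);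
* in such a basis (hypotheses `hM`, `hb` only): `toMatrix_a` — `[a] = diag(i, −i)`; `toMatrix_b` — `[b] = (0 −1; 1 0)`;
  `toMatrix_Q` — `[Q] = (0 Ω; −Ω 0)` with `Ω_pq = Q(m_p, b m_q)` alternating (`omega_transpose`, `omega_diag`); vectors of
  `M` have no `inr`-coordinates (`repr_inr_eq_zero`); `isAlt_toBilin'_omega`, `nondegenerate_toBilin'_omega` (the latter
  from `exists_hyperbolic_partner`, p705032), `isUnit_det_omega`;
* **`exists_centraliser_of_transpose_mul_omega_mul`** — every `γ ∈ Sp(Ω)` (`γᵀ Ω γ = Ω`) is the `M`-block of an element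
  of the quaternionic-unitary centraliser: there is `z ∈ GL(V)` commuting with `a, b`, preserving `Q`, with
  `[z]_β = fromBlocks γ 0 0 γ`.

Consumer: F1C `Q8SymplecticPowersQuaternionicTensorFFT`. HONEST FRAMING: linear algebra only (axioms standard); item 24191
OPEN; nothing here says HC ∕ HC_CM ∕ HC_AV is proved. References: R. Goodman, N. Wallach, *Symmetry, Representations, and
Invariants*, GTM 255, §11.3.5, §1.1.2 [cite: GoodmanWallachGTM255]; O. T. O'Meara, *Introduction to Quadratic Forms* (1963),
§41–§43 [cite: Omeara1963].
-/

set_option linter.dupNamespace false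

noncomputable section

open Module
open scoped BigOperators Matrix

namespace Summit.HodgeConjecture.HodgeConjecture.Theorems.Q8SymplecticPowersQuaternionicAdaptedBasis

open Summit.HodgeConjecture.HodgeConjecture.Theorems.Q8CommutatorDegreeTwoCoreTransvections
open Summit.HodgeConjecture.HodgeConjecture.Theorems.Q8CommutatorDegreeTwoCore
open Summit.HodgeConjecture.HodgeConjecture.Theorems.Q8QuaternionicTransvectionDensity

universe u v

variable {K : Type u} [Field K] {V : Type v} [AddCommGroup V] [Module K V]
  {Q : LinearMap.BilinForm K V} {a b : V →ₗ[K] V} {i : K}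

/-! ### §1 Existence of an adapted basis -/

/-- `i ≠ 0`. [folklore] -/
theorem i_ne_zero (hi : i * i = -1) : i ≠ 0 := by
  rintro rfl
  rw [zero_mul] at hi
  exact one_ne_zero (neg_eq_zero.1 hi.symm)

/-- `M ∩ M⁻ = 0`: a vector on which `a` acts by `i` and by `−i` vanishes (characteristic `0`). [folklore] -/
theorem eq_zero_of_eigen_both [CharZero K] (hi : i * i = -1) {x : V} (h1 : a x = i • x) (h2 : a x = (-i) • x) :
    x = 0 := by
  have h : i • x = -(i • x) := by
    calc i • x = a x := h1.symm
      _ = (-i) • x := h2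
      _ = -(i • x) := neg_smul i x
  have h4 : (2 : K) • (i • x) = 0 := by
    rw [two_smul]
    nth_rewrite 2 [h]
    rw [add_neg_cancel]
  rcases smul_eq_zero.1 h4 with h2' | h3
  · exact absurd h2' two_ne_zero
  · rcases smul_eq_zero.1 h3 with h5 | h6
    · exact absurd h5 (i_ne_zero hi)
    · exact h6

/-- **The adapted basis**: a finite-dimensional quadratic `K`-space with a quaternionic structure `(a, b)` has a basis
`β : Fin k ⊕ Fin k → V` consisting of a basis `m_p = β(inl p)` of `M = ker (a − i)` followed by `β(inr p) = b m_p`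
(`V = M ⊕ bM`, `bM = ker (a + i)`). [cite: GoodmanWallachGTM255, §11.3.5] -/
theorem exists_adaptedBasis [CharZero K] [Module.Finite K V] (haa : ∀ x, a (a x) = -x) (hbb : ∀ x, b (b x) = -x)
    (hab : ∀ x, a (b x) = -b (a x)) (hi : i * i = -1) :
    ∃ (k : ℕ) (β : Basis (Fin k ⊕ Fin k) K V),
      (∀ p, a (β (Sum.inl p)) = i • β (Sum.inl p)) ∧ (∀ p, β (Sum.inr p) = b (β (Sum.inl p))) := by
  classical
  set M : Submodule K V := Module.End.eigenspace a i with hMdef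
  let bM := Module.finBasis K M
  set k := Module.finrank K M with hk
  let f : Fin k ⊕ Fin k → V := Sum.elim (fun p => (bM p : V)) (fun p => b (bM p : V))
  have hfM : ∀ p, a (bM p : V) = i • (bM p : V) := fun p => Module.End.mem_eigenspace_iff.1 (bM p).2
  have hbneg : ∀ m : V, a m = i • m → a (b m) = (-i) • b m := fun m hm => by rw [hab, hm, map_smul, neg_smul]
  have hbinj : ∀ x : V, b x = 0 → x = 0 := fun x hx => by
    have h := hbb x
    rw [hx, map_zero] at h
    exact neg_eq_zero.1 h.symm
  -- linear independence
  have hli : LinearIndependent K f := by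
    rw [Fintype.linearIndependent_iff]
    intro g hg
    rw [Fintype.sum_sum_type] at hg
    simp only [f, Sum.elim_inl, Sum.elim_inr] at hg
    set u : V := ∑ p, g (Sum.inl p) • (bM p : V) with hu
    set u' : V := ∑ p, g (Sum.inr p) • b (bM p : V) with hu'
    have hau : a u = i • u := by
      rw [hu, map_sum, Finset.smul_sum]
      refine Finset.sum_congr rfl fun p _ => ?_
      rw [map_smul, hfM, smul_comm]
    have hau' : a u' = (-i) • u' := by
      rw [hu', map_sum, Finset.smul_sum]
      refine Finset.sum_congr rfl fun p _ => ?_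
      rw [map_smul, hbneg _ (hfM p), smul_comm]
    have huu' : u = -u' := eq_neg_of_add_eq_zero_left hg
    have hau2 : a u = (-i) • u := by
      rw [huu', map_neg, hau', smul_neg]
    have hu0 : u = 0 := eq_zero_of_eigen_both hi hau hau2
    have hu'0 : u' = 0 := by rw [huu', neg_eq_zero] at hu0; exact hu0
    -- the `inl` coefficients
    have h1 : ∀ p, g (Sum.inl p) = 0 := by
      have hsum : (∑ p, g (Sum.inl p) • bM p : M) = 0 := by
        apply Subtype.ext
        rw [Submodule.coe_sum, Submodule.coe_zero, ← hu0, hu]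
        exact Finset.sum_congr rfl fun p _ => by rw [Submodule.coe_smul]
      exact Fintype.linearIndependent_iff.1 bM.linearIndependent _ hsum
    -- the `inr` coefficients
    have h2 : ∀ p, g (Sum.inr p) = 0 := by
      have hb0 : b (∑ p, g (Sum.inr p) • (bM p : V)) = 0 := by
        rw [map_sum, ← hu'0, hu']
        exact Finset.sum_congr rfl fun p _ => by rw [map_smul]
      have hsum : (∑ p, g (Sum.inr p) • bM p : M) = 0 := by
        apply Subtype.ext
        rw [Submodule.coe_sum, Submodule.coe_zero, ← hbinj _ hb0]
        exact Finset.sum_congr rfl fun p _ => by rw [Submodule.coe_smul]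
      exact Fintype.linearIndependent_iff.1 bM.linearIndependent _ hsum
    intro x
    rcases x with p | p
    · exact h1 p
    · exact h2 p
  -- spanning
  have hMspan : ∀ m : V, a m = i • m → m ∈ Submodule.span K (Set.range f) := by
    intro m hm
    have hmM : m ∈ M := Module.End.mem_eigenspace_iff.2 hm
    have hrepr := bM.sum_repr ⟨m, hmM⟩
    have hm' : m = ∑ p, bM.repr ⟨m, hmM⟩ p • (bM p : V) := by
      have h := congr_arg Subtype.val hrepr
      rw [Submodule.coe_sum] at h
      simp only [Submodule.coe_smul] at h
      exact h.symm
    rw [hm']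
    exact Submodule.sum_mem _ fun p _ => Submodule.smul_mem _ _ (Submodule.subset_span ⟨Sum.inl p, rfl⟩)
  have hsp : ⊤ ≤ Submodule.span K (Set.range f) := by
    intro x _
    -- `x = ½ (x − i a x) + ½ (x + i a x)`, the first in `M`, the second in `bM`
    have h₁ : x - i • a x ∈ Submodule.span K (Set.range f) := hMspan _ (a_sub_smul haa hi x)
    have h₂ : x + i • a x ∈ Submodule.span K (Set.range f) := by
      have hy : a (b (x + i • a x)) = i • b (x + i • a x) := a_b_of_neg hab (a_add_smul haa hi x)
      have hbyM : b (x + i • a x) ∈ M := Module.End.mem_eigenspace_iff.2 hy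
      have hrepr := bM.sum_repr ⟨_, hbyM⟩
      have hby : b (x + i • a x) = ∑ p, bM.repr ⟨_, hbyM⟩ p • (bM p : V) := by
        have h := congr_arg Subtype.val hrepr
        rw [Submodule.coe_sum] at h
        simp only [Submodule.coe_smul] at h
        exact h.symm
      have hxw : x + i • a x = -∑ p, bM.repr ⟨_, hbyM⟩ p • b (bM p : V) := by
        have h := hbb (x + i • a x)
        rw [hby, map_sum] at h
        simp only [map_smul] at h
        rw [h, neg_neg]
      rw [hxw]
      exact Submodule.neg_mem _
        (Submodule.sum_mem _ fun p _ => Submodule.smul_mem _ _ (Submodule.subset_span ⟨Sum.inr p, rfl⟩))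
    have hx : x = (2 : K)⁻¹ • ((x - i • a x) + (x + i • a x)) := by
      rw [show (x - i • a x) + (x + i • a x) = (2 : K) • x by rw [two_smul]; abel, smul_smul,
        inv_mul_cancel₀ (two_ne_zero : (2 : K) ≠ 0), one_smul]
    rw [hx]
    exact Submodule.smul_mem _ _ (Submodule.add_mem _ h₁ h₂)
  refine ⟨k, Basis.mk hli hsp, fun p => ?_, fun p => ?_⟩
  · rw [Basis.mk_apply]; exact hfM p
  · rw [Basis.mk_apply, Basis.mk_apply]; rfl

/-! ### §2 Block forms in an adapted basis -/

section Blocks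

variable {k : ℕ} (β : Basis (Fin k ⊕ Fin k) K V) (hM : ∀ p, a (β (Sum.inl p)) = i • β (Sum.inl p))
  (hb : ∀ p, β (Sum.inr p) = b (β (Sum.inl p)))

/-- The Gram matrix `Ω_pq = Q(m_p, b m_q)` of `ω(x, y) = Q(x, by)` on the basis `m_p = β(inl p)` of `M`. Local notation. -/
local notation3 (prettyPrint := false) "Ω" => (Matrix.of fun p q : Fin k => Q (β (Sum.inl p)) (β (Sum.inr q)))

include hM hb

/-- `a (b m_p) = −i · b m_p`. [cite: GoodmanWallachGTM255, §11.3.5] -/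
theorem a_inr (hab : ∀ x, a (b x) = -b (a x)) (p : Fin k) : a (β (Sum.inr p)) = (-i) • β (Sum.inr p) := by
  rw [hb, hab, hM, map_smul, neg_smul]

/-- **`[a]_β = diag(i·1, −i·1)`.** [cite: GoodmanWallachGTM255, §11.3.5] -/
theorem toMatrix_a (hab : ∀ x, a (b x) = -b (a x)) :
    LinearMap.toMatrix β β a = Matrix.fromBlocks (i • (1 : Matrix (Fin k) (Fin k) K)) 0 0 ((-i) • 1) := by
  ext x y
  rw [LinearMap.toMatrix_apply]
  rcases y with p | p
  · rw [hM, map_smul, Basis.repr_self]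
    rcases x with q | q
    · rw [Matrix.fromBlocks_apply₁₁, Finsupp.smul_apply, Finsupp.single_apply, Matrix.smul_apply, Matrix.one_apply]
      by_cases h : q = p
      · subst h; simp
      · rw [if_neg (fun h' => h (Sum.inl_injective h'.symm)), if_neg h, smul_zero]
    · rw [Matrix.fromBlocks_apply₂₁, Finsupp.smul_apply, Finsupp.single_apply, if_neg Sum.inl_ne_inr, smul_zero,
        Matrix.zero_apply]
  · rw [a_inr β hM hb hab, map_smul, Basis.repr_self]
    rcases x with q | q
    · rw [Matrix.fromBlocks_apply₁₂, Finsupp.smul_apply, Finsupp.single_apply, if_neg Sum.inr_ne_inl, smul_zero,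
        Matrix.zero_apply]
    · rw [Matrix.fromBlocks_apply₂₂, Finsupp.smul_apply, Finsupp.single_apply, Matrix.smul_apply, Matrix.one_apply]
      by_cases h : q = p
      · subst h; simp
      · rw [if_neg (fun h' => h (Sum.inr_injective h'.symm)), if_neg h, smul_zero]

omit hM in
/-- **`[b]_β = (0 −1; 1 0)`.** [cite: GoodmanWallachGTM255, §11.3.5] -/
theorem toMatrix_b (hbb : ∀ x, b (b x) = -x) :
    LinearMap.toMatrix β β b = Matrix.fromBlocks (0 : Matrix (Fin k) (Fin k) K) (-1) 1 0 := by
  ext x y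
  rw [LinearMap.toMatrix_apply]
  rcases y with p | p
  · rw [← hb, Basis.repr_self]
    rcases x with q | q
    · rw [Matrix.fromBlocks_apply₁₁, Finsupp.single_apply, if_neg Sum.inr_ne_inl, Matrix.zero_apply]
    · rw [Matrix.fromBlocks_apply₂₁, Finsupp.single_apply, Matrix.one_apply]
      by_cases h : q = p
      · subst h; simp
      · rw [if_neg (fun h' => h (Sum.inr_injective h'.symm)), if_neg h]
  · rw [hb, hbb, map_neg, Basis.repr_self]
    rcases x with q | q
    · rw [Matrix.fromBlocks_apply₁₂, Finsupp.neg_apply, Finsupp.single_apply, Matrix.neg_apply, Matrix.one_apply]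
      by_cases h : q = p
      · subst h; simp
      · rw [if_neg (fun h' => h (Sum.inl_injective h'.symm)), if_neg h, neg_zero]
    · rw [Matrix.fromBlocks_apply₂₂, Finsupp.neg_apply, Finsupp.single_apply, if_neg Sum.inl_ne_inr, neg_zero,
        Matrix.zero_apply]

omit hM in
/-- `ω` is alternating on `M`: `Q(m_p, b m_q) = −Q(m_q, b m_p)`. [cite: Omeara1963, §41] -/
theorem omega_transpose (hQs : ∀ x y, Q x y = Q y x) (hbb : ∀ x, b (b x) = -x) (hQb : ∀ x y, Q (b x) (b y) = Q x y) :
    (Ω)ᵀ = -Ω := by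
  ext p q
  rw [Matrix.transpose_apply, Matrix.of_apply, Matrix.neg_apply, Matrix.of_apply, hb, hb]
  have h := hQb (β (Sum.inl p)) (b (β (Sum.inl q)))
  rw [hbb, map_neg] at h
  rw [← h, hQs, neg_neg]

omit hM in
/-- `Q(m_p, b m_p) = 0`. [cite: Omeara1963, §41] -/
theorem omega_diag [CharZero K] (hQs : ∀ x y, Q x y = Q y x) (hbb : ∀ x, b (b x) = -x) (hQb : ∀ x y, Q (b x) (b y) = Q x y)
    (p : Fin k) : Q (β (Sum.inl p)) (β (Sum.inr p)) = 0 := by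
  rw [hb]; exact b_self hQs hbb hQb _

/-- **`[Q]_β = (0 Ω; −Ω 0)`**: `M` and `bM` are totally isotropic and paired by `ω`. [cite: GoodmanWallachGTM255, §11.3.5]
[cite: Omeara1963, §42] -/
theorem toMatrix_Q [CharZero K] (hQs : ∀ x y, Q x y = Q y x) (hbb : ∀ x, b (b x) = -x) (hab : ∀ x, a (b x) = -b (a x))
    (haQ : ∀ x y, Q (a x) (a y) = Q x y) (hQb : ∀ x y, Q (b x) (b y) = Q x y) (hi : i * i = -1) :
    LinearMap.BilinForm.toMatrix β Q = Matrix.fromBlocks (0 : Matrix (Fin k) (Fin k) K) Ω (-Ω) 0 := by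
  have hi' : (-i) * (-i) = -1 := by rw [neg_mul_neg, hi]
  ext x y
  rw [LinearMap.BilinForm.toMatrix_apply]
  rcases x with p | p <;> rcases y with q | q
  · rw [Matrix.fromBlocks_apply₁₁, Matrix.zero_apply]
    exact eigen_isotropic haQ hi (hM p) (hM q)
  · rw [Matrix.fromBlocks_apply₁₂, Matrix.of_apply]
  · rw [Matrix.fromBlocks_apply₂₁, Matrix.neg_apply, Matrix.of_apply, hb p, hQs]
    have hT := congr_fun (congr_fun (omega_transpose β hb hQs hbb hQb) p) q
    rw [Matrix.transpose_apply, Matrix.neg_apply, Matrix.of_apply, Matrix.of_apply, hb p] at hT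
    exact hT
  · rw [Matrix.fromBlocks_apply₂₂, Matrix.zero_apply]
    exact eigen_isotropic haQ hi' (a_inr β hM hb hab p) (a_inr β hM hb hab q)

/-- **Vectors of `M` have no `bM`-coordinates** in an adapted basis. [cite: GoodmanWallachGTM255, §11.3.5] -/
theorem repr_inr_eq_zero [CharZero K] (hab : ∀ x, a (b x) = -b (a x)) (hi : i * i = -1) {x : V} (hx : a x = i • x)
    (q : Fin k) : β.repr x (Sum.inr q) = 0 := by
  have h := LinearMap.toMatrix_mulVec_repr β β a x
  rw [toMatrix_a β hM hb hab, hx, map_smul] at h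
  have hq := congr_fun h (Sum.inr q)
  rw [Matrix.mulVec, dotProduct, Fintype.sum_sum_type, Finsupp.coe_smul, Pi.smul_apply, smul_eq_mul] at hq
  simp only [Matrix.fromBlocks_apply₂₁, Matrix.zero_apply, zero_mul, Finset.sum_const_zero, zero_add,
    Matrix.fromBlocks_apply₂₂, Matrix.smul_apply, Matrix.one_apply, smul_eq_mul, mul_ite, mul_one, mul_zero, ite_mul,
    Finset.sum_ite_eq, Finset.mem_univ, if_true] at hq
  -- `hq : -i * β.repr x (inr q) = i * β.repr x (inr q)`
  have h2 : (2 * i) * β.repr x (Sum.inr q) = 0 := by linear_combination (-1 : K) * hq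
  rcases mul_eq_zero.1 h2 with h3 | h3
  · exact absurd h3 (mul_ne_zero two_ne_zero (i_ne_zero hi))
  · exact h3

/-- A vector of `M` is the combination of the `m_p` with its `inl`-coordinates. [cite: GoodmanWallachGTM255, §11.3.5] -/
theorem eq_sum_repr_inl [CharZero K] (hab : ∀ x, a (b x) = -b (a x)) (hi : i * i = -1) {x : V} (hx : a x = i • x) :
    x = ∑ p, β.repr x (Sum.inl p) • β (Sum.inl p) := by
  conv_lhs => rw [← β.sum_repr x, Fintype.sum_sum_type]
  simp only [repr_inr_eq_zero β hM hb hab hi hx, zero_smul, Finset.sum_const_zero, add_zero]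

omit hM in
/-- The form `ω` on coordinate vectors: `vᵀ Ω w = Q(Σ v_p m_p, b Σ w_q m_q)`. [cite: GoodmanWallachGTM255, §11.3.5] -/
theorem toBilin'_omega_apply (v w : Fin k → K) :
    Matrix.toBilin' Ω v w = Q (∑ p, v p • β (Sum.inl p)) (b (∑ q, w q • β (Sum.inl q))) := by
  rw [Matrix.toBilin'_apply']
  simp only [map_sum, map_smul, LinearMap.sum_apply, LinearMap.smul_apply, smul_eq_mul, dotProduct, Matrix.mulVec,
    Matrix.of_apply, Finset.mul_sum, hb]
  rw [Finset.sum_comm]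
  refine Finset.sum_congr rfl fun p _ => Finset.sum_congr rfl fun q _ => ?_
  ring

omit hM in
/-- **`Ω` is alternating.** [cite: Omeara1963, §41] -/
theorem isAlt_toBilin'_omega [CharZero K] (hQs : ∀ x y, Q x y = Q y x) (hbb : ∀ x, b (b x) = -x) (hQb : ∀ x y, Q (b x) (b y) = Q x y) :
    (Matrix.toBilin' Ω).IsAlt := by
  intro v
  rw [toBilin'_omega_apply β hb]
  exact b_self hQs hbb hQb _

/-- **`Ω` is non-degenerate** (`ω` is non-degenerate on `M`: `exists_hyperbolic_partner`). [cite: Omeara1963, §42] -/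
theorem nondegenerate_toBilin'_omega [CharZero K] (hQs : ∀ x y, Q x y = Q y x) (hQn : Q.Nondegenerate)
    (haa : ∀ x, a (a x) = -x) (hbb : ∀ x, b (b x) = -x) (hab : ∀ x, a (b x) = -b (a x))
    (haQ : ∀ x y, Q (a x) (a y) = Q x y) (hi : i * i = -1) : (Matrix.toBilin' Ω).Nondegenerate := by
  refine LinearMap.BilinForm.Nondegenerate.ofSeparatingLeft ?_
  intro v hv
  set x : V := ∑ p, v p • β (Sum.inl p) with hxdef
  have hxM : a x = i • x := by
    rw [hxdef, map_sum, Finset.smul_sum]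
    exact Finset.sum_congr rfl fun p _ => by rw [map_smul, hM, smul_comm]
  have hx0 : x = 0 := by
    by_contra hx0
    obtain ⟨w, hw, hxw⟩ := exists_hyperbolic_partner hQs hQn haa hbb hab haQ hi hx0 hxM
    have h := hv (fun q => β.repr w (Sum.inl q))
    rw [toBilin'_omega_apply β hb, ← hxdef, ← eq_sum_repr_inl β hM hb hab hi hw, hxw] at h
    exact one_ne_zero h
  -- `x = 0` forces `v = 0` (the `m_p` are independent)
  have hli := Fintype.linearIndependent_iff.1 (β.linearIndependent.comp Sum.inl Sum.inl_injective) v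
    (by rw [← hx0, hxdef]; rfl)
  funext p
  exact hli p

/-- `det Ω ≠ 0`. [cite: Omeara1963, §42] -/
theorem isUnit_det_omega [CharZero K] (hQs : ∀ x y, Q x y = Q y x) (hQn : Q.Nondegenerate)
    (haa : ∀ x, a (a x) = -x) (hbb : ∀ x, b (b x) = -x) (hab : ∀ x, a (b x) = -b (a x))
    (haQ : ∀ x y, Q (a x) (a y) = Q x y) (hi : i * i = -1) : IsUnit (Matrix.det Ω) :=
  isUnit_iff_ne_zero.2 (LinearMap.BilinForm.nondegenerate_toBilin'_iff_det_ne_zero.1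
    (nondegenerate_toBilin'_omega β hM hb hQs hQn haa hbb hab haQ hi))

/-! ### §3 The diagonal `Sp(Ω)` lies in the quaternionic-unitary centraliser -/

/-- **Every `γ ∈ Sp(Ω)` is the `M`-block of an element of the quaternionic-unitary centraliser**: for `γᵀ Ω γ = Ω` there is
`z ∈ GL(V)` commuting with `a` and `b`, preserving `Q`, with `[z]_β = fromBlocks γ 0 0 γ` (`z = γ` on `M`, `bγb⁻¹` on `bM`).
[cite: GoodmanWallachGTM255, §11.3.5 and §1.1.2] -/
theorem exists_centraliser_of_transpose_mul_omega_mul [CharZero K] (hQs : ∀ x y, Q x y = Q y x) (hQn : Q.Nondegenerate)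
    (haa : ∀ x, a (a x) = -x) (hbb : ∀ x, b (b x) = -x) (hab : ∀ x, a (b x) = -b (a x))
    (haQ : ∀ x y, Q (a x) (a y) = Q x y) (hQb : ∀ x y, Q (b x) (b y) = Q x y) (hi : i * i = -1)
    (γ : Matrix (Fin k) (Fin k) K) (hγ : γᵀ * Ω * γ = Ω) :
    ∃ z : V ≃ₗ[K] V, (∀ x, z (a x) = a (z x)) ∧ (∀ x, z (b x) = b (z x)) ∧ (∀ x y, Q (z x) (z y) = Q x y) ∧
      LinearMap.toMatrix β β (z : V →ₗ[K] V) = Matrix.fromBlocks γ 0 0 γ := by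
  have hQm := toMatrix_Q β hM hb hQs hbb hab haQ hQb hi
  have hΩ := isUnit_det_omega β hM hb hQs hQn haa hbb hab haQ hi
  set Ω' : Matrix (Fin k) (Fin k) K := Matrix.of fun p q : Fin k => Q (β (Sum.inl p)) (β (Sum.inr q)) with hΩ'
  -- `γ` is invertible
  have hγdet : IsUnit γ.det := by
    have h := congr_arg Matrix.det hγ
    rw [Matrix.det_mul, Matrix.det_mul, Matrix.det_transpose] at h
    have h2 : γ.det * γ.det * Matrix.det Ω = 1 * Matrix.det Ω := by linear_combination h
    exact IsUnit.of_mul_eq_one _ (mul_right_cancel₀ hΩ.ne_zero h2)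
  have hGdet : IsUnit (Matrix.fromBlocks γ 0 0 γ).det := by
    rw [Matrix.det_fromBlocks_zero₂₁]; exact hγdet.mul hγdet
  set z : V ≃ₗ[K] V := Matrix.toLinearEquiv β (Matrix.fromBlocks γ 0 0 γ) hGdet with hzdef
  have hz : ((z : V ≃ₗ[K] V) : V →ₗ[K] V) = Matrix.toLin β β (Matrix.fromBlocks γ 0 0 γ) :=
    LinearMap.ext fun x => Matrix.toLinearEquiv_apply β _ hGdet x
  have hzm : LinearMap.toMatrix β β (z : V →ₗ[K] V) = Matrix.fromBlocks γ 0 0 γ := by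
    rw [hz, LinearMap.toMatrix_toLin]
  -- commutation with `a`, `b` and the isometry property, in matrices
  have hza : (z : V →ₗ[K] V) ∘ₗ a = a ∘ₗ (z : V →ₗ[K] V) := by
    apply (LinearMap.toMatrix β β).injective
    rw [LinearMap.toMatrix_comp β β β, LinearMap.toMatrix_comp β β β, hzm, toMatrix_a β hM hb hab,
      Matrix.fromBlocks_multiply, Matrix.fromBlocks_multiply]
    simp
  have hzb : (z : V →ₗ[K] V) ∘ₗ b = b ∘ₗ (z : V →ₗ[K] V) := by
    apply (LinearMap.toMatrix β β).injective
    rw [LinearMap.toMatrix_comp β β β, LinearMap.toMatrix_comp β β β, hzm, toMatrix_b β hb hbb,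
      Matrix.fromBlocks_multiply, Matrix.fromBlocks_multiply]
    simp
  have hzQ : Q.comp (z : V →ₗ[K] V) (z : V →ₗ[K] V) = Q := by
    apply (LinearMap.BilinForm.toMatrix β).injective
    rw [LinearMap.BilinForm.toMatrix_comp β β, hzm, hQm, Matrix.fromBlocks_transpose, Matrix.fromBlocks_multiply,
      Matrix.fromBlocks_multiply]
    simp only [Matrix.transpose_zero, Matrix.zero_mul, Matrix.mul_zero, add_zero, zero_add, Matrix.mul_neg,
      Matrix.neg_mul, hγ, neg_zero]
  refine ⟨z, fun x => ?_, fun x => ?_, fun x y => ?_, hzm⟩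
  · simpa only [LinearMap.comp_apply, LinearEquiv.coe_coe] using LinearMap.congr_fun hza x
  · simpa only [LinearMap.comp_apply, LinearEquiv.coe_coe] using LinearMap.congr_fun hzb x
  · simpa only [LinearMap.BilinForm.comp_apply, LinearEquiv.coe_coe] using
      congr_arg (fun C : LinearMap.BilinForm K V => C x y) hzQ

end Blocks

end Summit.HodgeConjecture.HodgeConjecture.Theorems.Q8SymplecticPowersQuaternionicAdaptedBasis

end
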